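import Summits.ABC.ABC.Cruxes.EisensteinQuarantine.StrategistSketch
import Summits.ABC.ABC.Theorems.EisensteinQuarantine.Negative.EisensteinQuarantineFalseOfForcedPairDepthLaw
import HarnessLib

/-!
# Crux-strategist r1 (second opinion) on `EisensteinQuarantine` (stmt-ABC-15023): the TAMENESS CALCULUS

Companion to `STRATEGY-CENSUS.md` Part R1 (unit `cstrat-stmt-ABC-15023-r1`, 2026-08-17).  Sorry-free.  It reuses the
first strategist's allowance vocabulary (`Strategist.QuarantineWith`, `levelLoweringContent`, `D_signBlind`,
`D_residuacity`, crux workfile `StrategistSketch.lean`) and the landed negative lemmas, and adds ONE abstraction that makes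
the decomposition verdict of Part R1 kernel-checked:

* `Tame X` — "the budget `X(a,b,N,N⁻)` is `≤ C_ε N^ε 𝓛`" — is the crux with `sixPart ξ` replaced by an arbitrary budget
  (`eisensteinQuarantine_iff_tame : EisensteinQuarantine ↔ Tame sixPartXi`, by `Iff.rfl`);
* `ProthGrowth X` / `ForcedPairGrowth X` — the budget is `≥ 2^{s-c}` along a Proth family `p ≡ 1 (2^s)`, `p ≤ 2^{As}` /
  `≥ 2^{v₂(q-1)-c}` at forced pairs — are the landed `ProthDepthFamily` / `ForcedPairDepthLaw` with `ordProj[2] ξ`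
  replaced by `X` (`Iff.rfl` both);
* `not_tame_of_prothGrowth : ProthGrowth X → ¬ Tame X` is p107816 (`EisensteinQuarantine_false_of_ProthDepthFamily`)
  with the Brandt number abstracted away — the analytic half of every refutation of this crux is budget-agnostic;
* `eisensteinQuarantine_of_quarantineWith_of_tame : QuarantineWith D → Tame D → EisensteinQuarantine` is the natural
  two-piece DECOMPOSITION of the crux through an allowance `D` ("ξ is within its Euler budget" ∧ "the budget is tame");
* `not_tame_D_signBlind`, `not_tame_D_residuacity` — for the two census-consistent allowances on file (cdisprove's C″ =
  the Diamond–Ribet local factors `c_q = q² − 1` [Cornell–Silverman–Stevens 1997, ch. XII Lemma 4.4], and the first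
  strategist's gated C⁗) the second piece is FALSE UNCONDITIONALLY (pure arithmetic + the tree's two-prime supply
  `exists_primes_two_pow_mul_dvd_sub_one`; no modular form enters).

Upshot (Part R1 §Decomposition): every split of the crux of the form "modular allowance ∧ arithmetic tameness" whose
first leaf survives the 80-row census has a PROVABLY false second leaf; the crux is the conjunction of a plausibly-true
modular statement (C″/C⁗, = `QuarantineWith D`) with a false arithmetic one, i.e. MISSTATED rather than summit-hard.
Nothing here is a proof or a disproof of the crux itself (that needs the depth law `ForcedPairGrowth twoPartXi =
ForcedPairDepthLaw`, census-true, unproved: floor = r8 ∧ r9 + a 2-adic `R = 𝕋` statement for `ρ̄ = 1 ⊕ 1`, Part R1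
§Transfer).
-/

set_option linter.dupNamespace false
set_option linter.unusedVariables false

noncomputable section

open scoped BigOperators
open Finset
open Literature.NumberTheory.Automorphic Literature.NumberTheory.EllipticCurves
open Summit.ABC.ABC.Theses.DefiniteXi
open Summit.ABC.ABC.Theorems.EisensteinQuarantine.Negative
open Summit.ABC.ABC.Cruxes.EisensteinQuarantine.Strategist

namespace Summit.ABC.ABC.Cruxes.EisensteinQuarantine.StrategistR1

/-! ## §0 Budgets and tameness -/

/-- A budget / depth quantity on Frey quarantine data `(a, b, N, N⁻)` (same type as the first strategist's
allowances `D`). -/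
abbrev Budget := ℤ → ℤ → ℕ → ℕ → ℕ

/-- `Tame X`: on admissible Frey quarantine data the budget `X` is at most `C_ε · N^ε · 𝓛`,
`𝓛 = levelLoweringContent` — literally the crux with `sixPart ξ` replaced by `X`. -/
def Tame (X : Budget) : Prop :=
  ∀ ε : ℝ, 0 < ε → ∃ C : ℝ, ∀ a b : ℤ, IsCoprime a b → a * b * (a + b) ≠ 0 →
    ∀ (N : ℕ) [NeZero N], (freyCurve a b).conductorNorm ℤ = N →
      ∀ Nm : ℕ, Odd Nm → Squarefree Nm → Odd Nm.primeFactors.card → Nm ∣ N →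
        ((X a b N Nm : ℕ) : ℝ) ≤ C * (N : ℝ) ^ ε * ((levelLoweringContent a b N Nm : ℕ) : ℝ)

/-- The `{2,3}`-part of the quarantined congruence number `ξ(E_{a,b}; N/N⁻, N⁻)`. -/
def sixPartXi : Budget := fun a b N Nm =>
  ordProj[2] (brandtXi (N / Nm) Nm (fun n => (freyCurve a b).LFunction n)) *
    ordProj[3] (brandtXi (N / Nm) Nm (fun n => (freyCurve a b).LFunction n))

/-- The `2`-part of the quarantined congruence number. -/
def twoPartXi : Budget := fun a b N Nm =>
  ordProj[2] (brandtXi (N / Nm) Nm (fun n => (freyCurve a b).LFunction n))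

/-- **The crux is the tameness of `sixPart ξ`** (definitional). -/
theorem eisensteinQuarantine_iff_tame : EisensteinQuarantine ↔ Tame sixPartXi := Iff.rfl

/-- The crux implies the tameness of the `2`-part alone (`ordProj[3] ξ ≥ 1`). -/
theorem tame_twoPartXi_of_eisensteinQuarantine (h : EisensteinQuarantine) : Tame twoPartXi := by
  intro ε hε
  obtain ⟨C, hC⟩ := h ε hε
  refine ⟨C, fun a b hab h0 N _ hN Nm h1 h2 h3 h4 => le_trans ?_ (hC a b hab h0 N hN Nm h1 h2 h3 h4)⟩
  have h3pos : 0 < ordProj[3] (brandtXi (N / Nm) Nm (fun n => (freyCurve a b).LFunction n)) :=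
    Nat.ordProj_pos _ 3
  change ((ordProj[2] (brandtXi (N / Nm) Nm (fun n => (freyCurve a b).LFunction n)) : ℕ) : ℝ) ≤ _
  exact_mod_cast Nat.le_mul_of_pos_right _ h3pos

/-! ## §1 Growth along Proth families and forced pairs (the landed hypotheses, budget-abstracted) -/

/-- `ProthGrowth X`: along a family of primes `p ≡ 1 (mod 2^s)`, `p ≤ 2^{As}`, `s → ∞`, the budget at the Frey data
`(a,b) = (−p, p−1)`, `N⁻ = p` is `≥ 2^{s−c}` — `ProthDepthFamily` with `ordProj[2] ξ ↦ X`. -/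
def ProthGrowth (X : Budget) : Prop :=
  ∃ c A : ℕ, ∀ s₀ : ℕ, ∃ s p : ℕ, s₀ ≤ s ∧ p.Prime ∧ 2 ^ s ∣ p - 1 ∧ p ≤ 2 ^ (A * s) ∧
    ∀ N : ℕ, (freyCurve (-(p : ℤ)) ((p - 1 : ℕ) : ℤ)).conductorNorm ℤ = N →
      2 ^ s ≤ 2 ^ c * X (-(p : ℤ)) ((p - 1 : ℕ) : ℤ) N p

/-- `ForcedPairGrowth X`: at forced pairs `(q, ℓ)` (`q ≠ 2`, `32 q ∣ ℓ − 1`) the budget at `E_(−ℓ, ℓ−1)`, `N⁻ = ℓ` is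
`≥ 2^{v₂(q−1) − c}` — `ForcedPairDepthLaw` with `ordProj[2] ξ ↦ X`. -/
def ForcedPairGrowth (X : Budget) : Prop :=
  ∃ c : ℕ, ∀ q ℓ : ℕ, q.Prime → ℓ.Prime → q ≠ 2 → 32 * q ∣ ℓ - 1 →
    ∀ N : ℕ, (freyCurve (-(ℓ : ℤ)) ((ℓ - 1 : ℕ) : ℤ)).conductorNorm ℤ = N →
      2 ^ ((q - 1).factorization 2) ≤ 2 ^ c * X (-(ℓ : ℤ)) ((ℓ - 1 : ℕ) : ℤ) N ℓ

/-- `ProthDepthFamily` (p107816) is `ProthGrowth` of the 2-part of `ξ` (definitional). -/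
theorem prothDepthFamily_iff : ProthDepthFamily ↔ ProthGrowth twoPartXi := Iff.rfl

/-- `ForcedPairDepthLaw` (p134266) is `ForcedPairGrowth` of the 2-part of `ξ` (definitional). -/
theorem forcedPairDepthLaw_iff : ForcedPairDepthLaw ↔ ForcedPairGrowth twoPartXi := Iff.rfl

/-- Forced-pair growth gives Proth growth, by the tree's unconditional two-prime supply
(`exists_primes_two_pow_mul_dvd_sub_one`, p132885) — the glue of `prothDepthFamily_of_forcedPairDepthLaw`, verbatim with
`X` for `ordProj[2] ξ`. -/
theorem prothGrowth_of_forcedPairGrowth (X : Budget) (hF : ForcedPairGrowth X) : ProthGrowth X := by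
  obtain ⟨A, s₁, hAs⟩ := Literature.NumberTheory.Sieve.PrimesInAPGallagher.exists_primes_two_pow_mul_dvd_sub_one
  obtain ⟨c, hc⟩ := hF
  refine ⟨c, A, fun s₀ => ?_⟩
  set s : ℕ := max s₀ (max s₁ 5) with hs
  have hs5 : 5 ≤ s := (le_max_right _ _).trans (le_max_right _ _)
  have hs₁ : s₁ ≤ s := (le_max_left _ _).trans (le_max_right _ _)
  have h32s : (32 : ℕ) ∣ 2 ^ s := by
    rw [show (32 : ℕ) = 2 ^ 5 by norm_num]; exact Nat.pow_dvd_pow 2 hs5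
  obtain ⟨q, ℓ, hq, hℓ, hsq, hsl, hℓA⟩ := hAs s hs₁
  have hq2 : q ≠ 2 := by
    intro h
    rw [h] at hsq
    have := Nat.le_of_dvd (by norm_num) (h32s.trans hsq)
    omega
  have h2sl : 2 ^ s ∣ ℓ - 1 := (Dvd.intro q rfl).trans hsl
  have h32q : 32 * q ∣ ℓ - 1 := (Nat.mul_dvd_mul_right h32s q).trans hsl
  refine ⟨s, ℓ, le_max_left _ _, hℓ, h2sl, hℓA, fun N hN => ?_⟩
  have h := hc q ℓ hq hℓ hq2 h32q N hN
  have hqm1 : q - 1 ≠ 0 := by have := hq.two_le; omega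
  have hsv : s ≤ (q - 1).factorization 2 :=
    (Nat.prime_two.pow_dvd_iff_le_factorization hqm1).mp hsq
  exact (Nat.pow_le_pow_right (by norm_num) hsv).trans h

/-! ## §2 The budget-agnostic refutation engine: Proth growth is never tame -/

/-- **A budget that grows along a Proth family is not tame** — p107816 with `ordProj[2] ξ` abstracted to `X`:
at `ε = 1/(8A)`, `N = rad(p(p−1)) ≤ p²`, `𝓛 ≤ τ((p−1)²) ≤ C_ε p^{2ε}`, so `2^s ≤ 2^c X ≤ K · p^{4ε} ≤ K · 2^{s/2}`,
absurd for `s` large.  The analytic half of every refutation of the crux, once and for all. -/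
theorem not_tame_of_prothGrowth (X : Budget) (hG : ProthGrowth X) : ¬ Tame X := by
  intro hT
  obtain ⟨c, A, hfam⟩ := hG
  -- exponents
  set A' : ℕ := max A 1 with hA'
  have hA'1 : 1 ≤ A' := le_max_right _ _
  have hA'R : (1 : ℝ) ≤ (A' : ℝ) := by exact_mod_cast hA'1
  have hA'0 : (0 : ℝ) < (A' : ℝ) := by linarith
  have hAA' : (A : ℝ) ≤ (A' : ℝ) := by exact_mod_cast le_max_left A 1
  set t : ℝ := 1 / (8 * (A' : ℝ)) with ht
  have ht0 : 0 < t := by rw [ht]; positivity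
  obtain ⟨C, hC⟩ := hT t ht0
  obtain ⟨Cd, hCd1, hCd⟩ := Literature.NumberTheory.Sieve.exists_card_divisors_le_mul_rpow ht0
  set C' : ℝ := max C 1 with hC'
  have hC'1 : 1 ≤ C' := le_max_right _ _
  have hC'0 : (0 : ℝ) ≤ C' := zero_le_one.trans hC'1
  have hCd0 : (0 : ℝ) ≤ Cd := zero_le_one.trans hCd1
  -- the constant and the choice of `s`
  set K : ℝ := (2 : ℝ) ^ c * C' * Cd with hK
  have hK0 : 0 ≤ K := by rw [hK]; exact mul_nonneg (mul_nonneg (by positivity) hC'0) hCd0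
  obtain ⟨n₀, hn₀⟩ := pow_unbounded_of_one_lt (K ^ 2) (by norm_num : (1 : ℝ) < 2)
  obtain ⟨s, p, hs₀, hp, hsp, hpA, hdep⟩ := hfam (max n₀ 5)
  have hs5 : 5 ≤ s := le_of_max_le_right hs₀
  have hKs : K ^ 2 < (2 : ℝ) ^ s := hn₀.trans_le (pow_le_pow_right₀ (by norm_num) (le_of_max_le_left hs₀))
  have hp1le : 1 ≤ p := hp.one_lt.le
  have hM0 : p - 1 ≠ 0 := by have := hp.two_le; omega
  have h2s_le : 2 ^ s ≤ p - 1 := Nat.le_of_dvd (Nat.pos_of_ne_zero hM0) hsp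
  have h32 : 2 ^ 5 ≤ p - 1 := (Nat.pow_le_pow_right (by norm_num) hs5).trans h2s_le
  norm_num at h32
  have hp2 : p ≠ 2 := by omega
  -- the Frey data `(a, b) = (−p, p−1)`
  set a : ℤ := -(p : ℤ) with ha
  set b : ℤ := ((p - 1 : ℕ) : ℤ) with hb
  have hpcast : (p : ℤ) = ((p - 1 : ℕ) : ℤ) + 1 := by
    rw [Nat.cast_sub hp1le]; push_cast; ring
  have hab_sum : a + b = -1 := by rw [ha, hb, hpcast]; ring
  have habc : a * b * (a + b) = ((p * (p - 1) : ℕ) : ℤ) := by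
    rw [hab_sum, ha, hb]; push_cast; ring
  have hPM0 : p * (p - 1) ≠ 0 := Nat.mul_ne_zero hp.ne_zero hM0
  have h0 : a * b * (a + b) ≠ 0 := by rw [habc]; exact_mod_cast hPM0
  have hab : IsCoprime a b := by
    rw [ha, hb, IsCoprime.neg_left_iff, Int.isCoprime_iff_gcd_eq_one, Int.gcd_natCast_natCast]
    exact (Nat.coprime_self_sub_right hp1le).mpr (Nat.coprime_one_right p)
  have h4M : (4 : ℕ) ∣ p - 1 :=
    (Nat.pow_dvd_pow 2 (show 2 ≤ s by omega)).trans hsp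
  have h32M : (32 : ℕ) ∣ p - 1 :=
    (Nat.pow_dvd_pow 2 hs5).trans hsp
  have ha4 : a ≡ -1 [ZMOD 4] := by
    have h4 : (4 : ℤ) ∣ b := by rw [hb]; exact_mod_cast h4M
    have : a = -1 - b := by rw [ha, hb, hpcast]; ring
    rw [this]
    calc -1 - b ≡ -1 - 0 [ZMOD 4] := Int.ModEq.sub_left _ ((Int.modEq_zero_iff_dvd).mpr h4)
      _ = -1 := by ring
  have hb32 : (32 : ℤ) ∣ b := by rw [hb]; exact_mod_cast h32M
  have hnatAbs : (a * b * (a + b)).natAbs = p * (p - 1) := by rw [habc, Int.natAbs_natCast]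
  -- the curve, its conductor and minimal discriminant
  set E := freyCurve a b with hE
  haveI : E.IsElliptic := isElliptic_freyCurve h0
  obtain ⟨N, hN⟩ : ∃ N : ℕ, E.conductorNorm ℤ = N := ⟨_, rfl⟩
  have hNval : N = UniqueFactorizationMonoid.radical (p * (p - 1)) := by
    rw [← hN, hE, conductorNorm_freyCurve_serre hab h0 ha4 hb32, hnatAbs]
  have hNpos : 0 < N := by rw [hNval]; exact Nat.radical_pos _
  haveI : NeZero N := ⟨hNpos.ne'⟩
  have hNle : N ≤ p * (p - 1) := by rw [hNval]; exact Nat.radical_le_self_iff.mpr hPM0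
  have hpN : p ∣ N := by
    rw [hNval]
    refine Nat.dvd_of_mem_primeFactors ?_
    rw [Nat.primeFactors_radical, Nat.primeFactors_mul hp.ne_zero hM0, hp.primeFactors]
    simp
  have hfac : ∀ q : ℕ, (E.minimalDiscriminantNorm ℤ).factorization q =
      2 * (p * (p - 1)).factorization q - if q = 2 then 8 else 0 := fun q => by
    rw [hE, factorization_minimalDiscriminantNorm_freyCurve_serre hab h0 ha4 hb32 q, hnatAbs]
  -- admissibility of `Nm := p` and tameness at this instance
  have hPodd : Odd p := hp.odd_of_ne_two hp2
  have hPcard : Odd p.primeFactors.card := by rw [hp.primeFactors]; simp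
  have hcrux := hC a b hab h0 N hN p hPodd hp.squarefree hPcard hpN
  change ((X a b N p : ℕ) : ℝ) ≤ C * (N : ℝ) ^ t *
    ((∏ q ∈ N.primeFactors \ p.primeFactors, (E.minimalDiscriminantNorm ℤ).factorization q : ℕ) : ℝ) at hcrux
  -- the growth inequality at this instance
  have hdepth : 2 ^ s ≤ 2 ^ c * X a b N p := hdep N hN
  -- the allowance: 𝓛 ≤ τ((p−1)²)
  have hLtau : (∏ q ∈ N.primeFactors \ p.primeFactors, (E.minimalDiscriminantNorm ℤ).factorization q) ≤
      #((p - 1) ^ 2).divisors := by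
    have hsd : N.primeFactors \ p.primeFactors = (p - 1).primeFactors := by
      rw [hNval]; exact primeFactors_radical_mul_pred_sdiff hp
    rw [hsd]
    refine le_trans ?_ (prod_two_mul_factorization_le_card_divisors_sq hM0)
    refine prod_le_prod (fun _ _ => Nat.zero_le _) fun q hq => ?_
    rw [hfac q, factorization_mul_pred_of_mem hp hq]
    exact Nat.sub_le _ _
  -- pass to ℝ
  have hpR : (0 : ℝ) < (p : ℝ) := by exact_mod_cast hp.pos
  have hX0 : (0 : ℝ) ≤ ((X a b N p : ℕ) : ℝ) := by positivity
  have hNR : (0 : ℝ) < (N : ℝ) := by exact_mod_cast hNpos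
  -- `N^t ≤ p^(2t)` and `τ ≤ Cd p^(2t)`
  have hp2R : ((p * (p - 1) : ℕ) : ℝ) ≤ (p : ℝ) ^ (2 : ℝ) := by
    rw [Real.rpow_two]
    have : p * (p - 1) ≤ p * p := Nat.mul_le_mul_left _ (Nat.sub_le _ _)
    calc ((p * (p - 1) : ℕ) : ℝ) ≤ ((p * p : ℕ) : ℝ) := by exact_mod_cast this
      _ = (p : ℝ) ^ 2 := by push_cast; ring
  have hNt : (N : ℝ) ^ t ≤ (p : ℝ) ^ (2 * t) := by
    rw [Real.rpow_mul hpR.le]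
    exact Real.rpow_le_rpow (Nat.cast_nonneg _) ((Nat.cast_le.mpr hNle).trans hp2R) ht0.le
  have hτ : (#((p - 1) ^ 2).divisors : ℝ) ≤ Cd * (p : ℝ) ^ (2 * t) := by
    have h1 := hCd ((p - 1) ^ 2) (pow_ne_zero 2 hM0)
    have h2 : ((((p - 1) ^ 2 : ℕ)) : ℝ) ≤ (p : ℝ) ^ (2 : ℝ) := by
      rw [Real.rpow_two]; push_cast
      have : ((p - 1 : ℕ) : ℝ) ≤ (p : ℝ) := by exact_mod_cast Nat.sub_le p 1
      exact pow_le_pow_left₀ (Nat.cast_nonneg _) this 2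
    calc (#((p - 1) ^ 2).divisors : ℝ) ≤ Cd * ((((p - 1) ^ 2 : ℕ)) : ℝ) ^ t := h1
      _ ≤ Cd * ((p : ℝ) ^ (2 : ℝ)) ^ t :=
          mul_le_mul_of_nonneg_left (Real.rpow_le_rpow (Nat.cast_nonneg _) h2 ht0.le) hCd0
      _ = Cd * (p : ℝ) ^ (2 * t) := by rw [Real.rpow_mul hpR.le]
  -- `X ≤ C' · p^(2t) · Cd · p^(2t)`
  have hLR : ((∏ q ∈ N.primeFactors \ p.primeFactors, (E.minimalDiscriminantNorm ℤ).factorization q : ℕ) : ℝ) ≤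
      Cd * (p : ℝ) ^ (2 * t) := (Nat.cast_le.mpr hLtau).trans hτ
  have hstep1 : ((X a b N p : ℕ) : ℝ) ≤ C' * (p : ℝ) ^ (2 * t) * (Cd * (p : ℝ) ^ (2 * t)) := by
    have hL0 : (0 : ℝ) ≤ ((∏ q ∈ N.primeFactors \ p.primeFactors,
        (E.minimalDiscriminantNorm ℤ).factorization q : ℕ) : ℝ) := by positivity
    calc ((X a b N p : ℕ) : ℝ)
        ≤ C * (N : ℝ) ^ t * ((∏ q ∈ N.primeFactors \ p.primeFactors,
            (E.minimalDiscriminantNorm ℤ).factorization q : ℕ) : ℝ) := hcrux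
      _ ≤ C' * (N : ℝ) ^ t * ((∏ q ∈ N.primeFactors \ p.primeFactors,
            (E.minimalDiscriminantNorm ℤ).factorization q : ℕ) : ℝ) :=
          mul_le_mul_of_nonneg_right
            (mul_le_mul_of_nonneg_right (le_max_left C 1) (Real.rpow_nonneg hNR.le _)) hL0
      _ ≤ C' * (p : ℝ) ^ (2 * t) * (Cd * (p : ℝ) ^ (2 * t)) :=
          mul_le_mul (mul_le_mul_of_nonneg_left hNt hC'0) hLR hL0
            (mul_nonneg hC'0 (Real.rpow_nonneg hpR.le _))
  -- `p^(4t) ≤ 2^(s/2)` along the family (`p ≤ 2^(A s)`, `4 t A ≤ 1/2`)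
  have hp4t : (p : ℝ) ^ (2 * t) * (p : ℝ) ^ (2 * t) = (p : ℝ) ^ (4 * t) := by
    rw [← Real.rpow_add hpR]; ring_nf
  set u : ℝ := (2 : ℝ) ^ ((s : ℝ) / 2) with hu
  have hu0 : 0 < u := by rw [hu]; positivity
  have huu : u * u = (2 : ℝ) ^ s := by
    rw [hu, ← Real.rpow_add (by norm_num : (0 : ℝ) < 2), ← Real.rpow_natCast (2 : ℝ) s]
    congr 1; ring
  have hpbound : (p : ℝ) ≤ (2 : ℝ) ^ (A * s) := by exact_mod_cast hpA
  have hexp_le : ((A * s : ℕ) : ℝ) * (4 * t) ≤ (s : ℝ) / 2 := by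
    have hA'ne : (A' : ℝ) ≠ 0 := hA'0.ne'
    have h1 : ((A * s : ℕ) : ℝ) * (4 * t) = (A : ℝ) / A' * ((s : ℝ) / 2) := by
      rw [ht]; push_cast; field_simp; ring
    rw [h1]
    exact mul_le_of_le_one_left (by positivity) ((div_le_one hA'0).mpr hAA')
  have hp4bound : (p : ℝ) ^ (4 * t) ≤ u := by
    have h4t : 0 ≤ 4 * t := by positivity
    calc (p : ℝ) ^ (4 * t) ≤ ((2 : ℝ) ^ (A * s)) ^ (4 * t) := Real.rpow_le_rpow hpR.le hpbound h4t
      _ = (2 : ℝ) ^ (((A * s : ℕ) : ℝ) * (4 * t)) := by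
          rw [← Real.rpow_natCast (2 : ℝ) (A * s), ← Real.rpow_mul (by norm_num : (0 : ℝ) ≤ 2)]
      _ ≤ (2 : ℝ) ^ ((s : ℝ) / 2) := Real.rpow_le_rpow_of_exponent_le (by norm_num) hexp_le
      _ = u := by rw [hu]
  -- combine: `u² = 2^s ≤ K · u`, so `2^s ≤ K²`, contradicting the choice of `s`
  have hdepthR : (2 : ℝ) ^ s ≤ (2 : ℝ) ^ c * ((X a b N p : ℕ) : ℝ) := by exact_mod_cast hdepth
  have hfinal : (2 : ℝ) ^ s ≤ K * u := by
    calc (2 : ℝ) ^ s ≤ (2 : ℝ) ^ c * ((X a b N p : ℕ) : ℝ) := hdepthR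
      _ ≤ (2 : ℝ) ^ c * (C' * (p : ℝ) ^ (2 * t) * (Cd * (p : ℝ) ^ (2 * t))) :=
          mul_le_mul_of_nonneg_left hstep1 (by positivity)
      _ = (2 : ℝ) ^ c * C' * Cd * (p : ℝ) ^ (4 * t) := by rw [← hp4t]; ring
      _ ≤ (2 : ℝ) ^ c * C' * Cd * u := mul_le_mul_of_nonneg_left hp4bound hK0
      _ = K * u := by rw [hK]
  rw [← huu] at hfinal
  have huK : u ≤ K := le_of_mul_le_mul_right hfinal hu0
  have hsq : (2 : ℝ) ^ s ≤ K ^ 2 := by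
    rw [← huu, sq]
    exact mul_le_mul huK huK hu0.le hK0
  linarith

/-- Forced-pair growth is never tame. -/
theorem not_tame_of_forcedPairGrowth (X : Budget) (hF : ForcedPairGrowth X) : ¬ Tame X :=
  not_tame_of_prothGrowth X (prothGrowth_of_forcedPairGrowth X hF)

/-- Consistency check: p107816 and p134266 are instances of the engine. -/
theorem eisensteinQuarantine_false_of_prothDepthFamily' (h : ProthDepthFamily) : ¬ EisensteinQuarantine :=
  fun hE => not_tame_of_prothGrowth twoPartXi (prothDepthFamily_iff.mp h) (tame_twoPartXi_of_eisensteinQuarantine hE)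

theorem eisensteinQuarantine_false_of_forcedPairDepthLaw' (h : ForcedPairDepthLaw) : ¬ EisensteinQuarantine :=
  fun hE => not_tame_of_forcedPairGrowth twoPartXi (forcedPairDepthLaw_iff.mp h)
    (tame_twoPartXi_of_eisensteinQuarantine hE)

/-! ## §3 The decomposition through an allowance, and why its arithmetic leaf is false -/

/-- **Glue of the decomposition `EQ ⟸ (ξ within budget D) ∧ (D tame)`.** -/
theorem eisensteinQuarantine_of_quarantineWith_of_tame (D : Budget) (hQ : QuarantineWith D) (hT : Tame D) :
    EisensteinQuarantine := by
  intro ε hε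
  obtain ⟨C₁, hC₁⟩ := hQ (ε / 2) (half_pos hε)
  obtain ⟨C₂, hC₂⟩ := hT (ε / 2) (half_pos hε)
  refine ⟨max C₁ 0 * max C₂ 0, fun a b hab h0 N _ hN Nm h1 h2 h3 h4 => ?_⟩
  have hq := hC₁ a b hab h0 N hN Nm h1 h2 h3 h4
  have ht := hC₂ a b hab h0 N hN Nm h1 h2 h3 h4
  have hN0 : (0 : ℝ) < (N : ℝ) := by exact_mod_cast Nat.pos_of_ne_zero (NeZero.ne N)
  have hNe : (0 : ℝ) ≤ (N : ℝ) ^ (ε / 2) := Real.rpow_nonneg hN0.le _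
  have hD0 : (0 : ℝ) ≤ ((D a b N Nm : ℕ) : ℝ) := Nat.cast_nonneg _
  have hL0 : (0 : ℝ) ≤ ((levelLoweringContent a b N Nm : ℕ) : ℝ) := Nat.cast_nonneg _
  have hsplit : (N : ℝ) ^ (ε / 2) * (N : ℝ) ^ (ε / 2) = (N : ℝ) ^ ε := by
    rw [← Real.rpow_add hN0, add_halves]
  have hC₁' : C₁ ≤ max C₁ 0 := le_max_left _ _
  have hC₂' : C₂ ≤ max C₂ 0 := le_max_left _ _
  have hM₁ : (0 : ℝ) ≤ max C₁ 0 := le_max_right _ _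
  have hM₂ : (0 : ℝ) ≤ max C₂ 0 := le_max_right _ _
  calc ((ordProj[2] (brandtXi (N / Nm) Nm (fun n => (freyCurve a b).LFunction n)) *
          ordProj[3] (brandtXi (N / Nm) Nm (fun n => (freyCurve a b).LFunction n)) : ℕ) : ℝ)
      ≤ C₁ * (N : ℝ) ^ (ε / 2) * ((D a b N Nm : ℕ) : ℝ) := hq
    _ ≤ max C₁ 0 * (N : ℝ) ^ (ε / 2) * ((D a b N Nm : ℕ) : ℝ) := by gcongr
    _ ≤ max C₁ 0 * (N : ℝ) ^ (ε / 2) * (C₂ * (N : ℝ) ^ (ε / 2) * ((levelLoweringContent a b N Nm : ℕ) : ℝ)) :=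
        mul_le_mul_of_nonneg_left ht (mul_nonneg hM₁ hNe)
    _ ≤ max C₁ 0 * (N : ℝ) ^ (ε / 2) * (max C₂ 0 * (N : ℝ) ^ (ε / 2) * ((levelLoweringContent a b N Nm : ℕ) : ℝ)) := by
        gcongr
    _ = max C₁ 0 * max C₂ 0 * ((N : ℝ) ^ (ε / 2) * (N : ℝ) ^ (ε / 2)) *
          ((levelLoweringContent a b N Nm : ℕ) : ℝ) := by ring
    _ = max C₁ 0 * max C₂ 0 * (N : ℝ) ^ ε * ((levelLoweringContent a b N Nm : ℕ) : ℝ) := by rw [hsplit]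

/-- Conversely a refuted tameness leaf kills the decomposition as a PROOF of the crux, and together with `ξ`
realising its budget (`ForcedPairGrowth sixPartXi`-type laws) kills the crux itself (`not_tame_of_forcedPairGrowth`). -/
theorem not_tame_of_quarantineWith_of_not (D : Budget) (hQ : QuarantineWith D) (hE : ¬ EisensteinQuarantine) :
    ¬ Tame D :=
  fun hT => hE (eisensteinQuarantine_of_quarantineWith_of_tame D hQ hT)

/-! ### The arithmetic of forced pairs (no modular forms) -/

/-- `2^{v₂(q−1)} ≤ sixPart(q² − 1)` for a prime `q`. [folklore] -/
theorem two_pow_factorization_le_sixPart_sq_sub_one {q : ℕ} (hq : q.Prime) :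
    2 ^ ((q - 1).factorization 2) ≤ ordProj[2] (q ^ 2 - 1) * ordProj[3] (q ^ 2 - 1) := by
  have hq1 : 1 ≤ q := hq.one_lt.le
  have hqm1 : q - 1 ≠ 0 := by have := hq.two_le; omega
  have hsq : q ^ 2 - 1 = (q - 1) * (q + 1) := by
    zify [hq1, Nat.one_le_pow 2 q hq.pos]
    ring
  have hsq0 : q ^ 2 - 1 ≠ 0 := by rw [hsq]; exact Nat.mul_ne_zero hqm1 (by omega)
  have hdvd : q - 1 ∣ q ^ 2 - 1 := by rw [hsq]; exact dvd_mul_right _ _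
  have hle : (q - 1).factorization 2 ≤ (q ^ 2 - 1).factorization 2 :=
    (Nat.factorization_le_iff_dvd hqm1 hsq0).mpr hdvd 2
  calc 2 ^ ((q - 1).factorization 2) ≤ 2 ^ ((q ^ 2 - 1).factorization 2) :=
        Nat.pow_le_pow_right (by norm_num) hle
    _ ≤ ordProj[2] (q ^ 2 - 1) * ordProj[3] (q ^ 2 - 1) :=
        Nat.le_mul_of_pos_right _ (Nat.ordProj_pos _ 3)

/-- The Frey data of a forced pair: non-degeneracy, and the unquarantined partner `q` is an odd level prime distinct
from the quarantined `ℓ` (`N = rad(ℓ(ℓ−1))` by Serre's conductor computation on the semistable Legendre model).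
[folklore] -/
theorem forcedPair_frey_data {q ℓ : ℕ} (hq : q.Prime) (hℓ : ℓ.Prime) (hq2 : q ≠ 2) (h32q : 32 * q ∣ ℓ - 1)
    {N : ℕ} (hN : (freyCurve (-(ℓ : ℤ)) ((ℓ - 1 : ℕ) : ℤ)).conductorNorm ℤ = N) :
    (-(ℓ : ℤ)) * ((ℓ - 1 : ℕ) : ℤ) * (-(ℓ : ℤ) + ((ℓ - 1 : ℕ) : ℤ)) ≠ 0 ∧
      q ∈ N.primeFactors ∧ q ∉ ℓ.primeFactors := by
  have hℓ1 : 1 ≤ ℓ := hℓ.one_lt.le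
  have hM0 : ℓ - 1 ≠ 0 := by have := hℓ.two_le; omega
  have hqd : q ∣ ℓ - 1 := (Dvd.intro_left 32 rfl).trans h32q
  have h32M : (32 : ℕ) ∣ ℓ - 1 := (Dvd.intro q rfl).trans h32q
  have h4M : (4 : ℕ) ∣ ℓ - 1 := (show (4 : ℕ) ∣ 32 by norm_num).trans h32M
  set a : ℤ := -(ℓ : ℤ) with ha
  set b : ℤ := ((ℓ - 1 : ℕ) : ℤ) with hb
  have hpcast : (ℓ : ℤ) = ((ℓ - 1 : ℕ) : ℤ) + 1 := by
    rw [Nat.cast_sub hℓ1]; push_cast; ring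
  have hab_sum : a + b = -1 := by rw [ha, hb, hpcast]; ring
  have habc : a * b * (a + b) = ((ℓ * (ℓ - 1) : ℕ) : ℤ) := by
    rw [hab_sum, ha, hb]; push_cast; ring
  have hPM0 : ℓ * (ℓ - 1) ≠ 0 := Nat.mul_ne_zero hℓ.ne_zero hM0
  have h0 : a * b * (a + b) ≠ 0 := by rw [habc]; exact_mod_cast hPM0
  have hab : IsCoprime a b := by
    rw [ha, hb, IsCoprime.neg_left_iff, Int.isCoprime_iff_gcd_eq_one, Int.gcd_natCast_natCast]
    exact (Nat.coprime_self_sub_right hℓ1).mpr (Nat.coprime_one_right ℓ)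
  have ha4 : a ≡ -1 [ZMOD 4] := by
    have h4 : (4 : ℤ) ∣ b := by rw [hb]; exact_mod_cast h4M
    have : a = -1 - b := by rw [ha, hb, hpcast]; ring
    rw [this]
    calc -1 - b ≡ -1 - 0 [ZMOD 4] := Int.ModEq.sub_left _ ((Int.modEq_zero_iff_dvd).mpr h4)
      _ = -1 := by ring
  have hb32 : (32 : ℤ) ∣ b := by rw [hb]; exact_mod_cast h32M
  have hnatAbs : (a * b * (a + b)).natAbs = ℓ * (ℓ - 1) := by rw [habc, Int.natAbs_natCast]
  have hNval : N = UniqueFactorizationMonoid.radical (ℓ * (ℓ - 1)) := by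
    rw [← hN, conductorNorm_freyCurve_serre hab h0 ha4 hb32, hnatAbs]
  refine ⟨h0, ?_, ?_⟩
  · rw [hNval, Nat.primeFactors_radical, Nat.primeFactors_mul hℓ.ne_zero hM0]
    exact Finset.mem_union_right _ (Nat.mem_primeFactors.mpr ⟨hq, hqd, hM0⟩)
  · rw [hℓ.primeFactors, Finset.mem_singleton]
    intro hql
    have : q ≤ ℓ - 1 := Nat.le_of_dvd (Nat.pos_of_ne_zero hM0) hqd
    omega

/-- **C″'s allowance grows at forced pairs** (the unquarantined partner alone contributes `(q² − 1)₂ ≥ 2^{v₂(q−1)}`):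
`ForcedPairGrowth D_signBlind`, unconditionally. -/
theorem forcedPairGrowth_D_signBlind : ForcedPairGrowth D_signBlind := by
  refine ⟨0, fun q ℓ hq hℓ hq2 h32q N hN => ?_⟩
  obtain ⟨h0, hqN, -⟩ := forcedPair_frey_data hq hℓ hq2 h32q hN
  rw [pow_zero, one_mul]
  have hq' : q ∈ N.primeFactors.erase 2 := Finset.mem_erase.mpr ⟨hq2, hqN⟩
  have hL : 1 ≤ levelLoweringContent (-(ℓ : ℤ)) ((ℓ - 1 : ℕ) : ℤ) N ℓ := one_le_allowance h0 hN _
  have hP : ordProj[2] (q ^ 2 - 1) * ordProj[3] (q ^ 2 - 1) ≤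
      ∏ r ∈ N.primeFactors.erase 2, ordProj[2] (r ^ 2 - 1) * ordProj[3] (r ^ 2 - 1) :=
    Finset.single_le_prod' (f := fun r => ordProj[2] (r ^ 2 - 1) * ordProj[3] (r ^ 2 - 1))
      (fun r _ => Nat.one_le_iff_ne_zero.mpr
        (Nat.mul_ne_zero (Nat.ordProj_pos (r ^ 2 - 1) 2).ne' (Nat.ordProj_pos (r ^ 2 - 1) 3).ne')) hq'
  calc 2 ^ ((q - 1).factorization 2) ≤ ordProj[2] (q ^ 2 - 1) * ordProj[3] (q ^ 2 - 1) :=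
        two_pow_factorization_le_sixPart_sq_sub_one hq
    _ ≤ ∏ r ∈ N.primeFactors.erase 2, ordProj[2] (r ^ 2 - 1) * ordProj[3] (r ^ 2 - 1) := hP
    _ ≤ levelLoweringContent (-(ℓ : ℤ)) ((ℓ - 1 : ℕ) : ℤ) N ℓ *
          ∏ r ∈ N.primeFactors.erase 2, ordProj[2] (r ^ 2 - 1) * ordProj[3] (r ^ 2 - 1) :=
        Nat.le_mul_of_pos_left _ hL

/-- **C⁗'s (gated) allowance grows at forced pairs** as well — the gate is on the QUARANTINED prime; the unquarantined
partner `q` is charged in full: `ForcedPairGrowth (D_residuacity B)` for every `B`, unconditionally. -/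
theorem forcedPairGrowth_D_residuacity (B : ℕ) : ForcedPairGrowth (D_residuacity B) := by
  refine ⟨0, fun q ℓ hq hℓ hq2 h32q N hN => ?_⟩
  obtain ⟨h0, hqN, hqℓ⟩ := forcedPair_frey_data hq hℓ hq2 h32q hN
  rw [pow_zero, one_mul]
  have hq' : q ∈ (N.primeFactors \ ℓ.primeFactors).erase 2 :=
    Finset.mem_erase.mpr ⟨hq2, Finset.mem_sdiff.mpr ⟨hqN, hqℓ⟩⟩
  have hL : 1 ≤ levelLoweringContent (-(ℓ : ℤ)) ((ℓ - 1 : ℕ) : ℤ) N ℓ := one_le_allowance h0 hN _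
  have hP : ordProj[2] (q ^ 2 - 1) * ordProj[3] (q ^ 2 - 1) ≤
      ∏ r ∈ (N.primeFactors \ ℓ.primeFactors).erase 2, ordProj[2] (r ^ 2 - 1) * ordProj[3] (r ^ 2 - 1) :=
    Finset.single_le_prod' (f := fun r => ordProj[2] (r ^ 2 - 1) * ordProj[3] (r ^ 2 - 1))
      (fun r _ => Nat.one_le_iff_ne_zero.mpr
        (Nat.mul_ne_zero (Nat.ordProj_pos (r ^ 2 - 1) 2).ne' (Nat.ordProj_pos (r ^ 2 - 1) 3).ne')) hq'
  have hG : 1 ≤ ∏ p ∈ ℓ.primeFactors,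
      min (ordProj[2] (p ^ 2 - 1) * ordProj[3] (p ^ 2 - 1))
        (2 ^ (resDepth 2 p 2 + B) * 3 ^ (resDepth 3 p 3 + B)) :=
    Nat.one_le_iff_ne_zero.mpr (Finset.prod_ne_zero_iff.mpr fun p _ => by
      refine (lt_min ?_ ?_).ne'
      · exact Nat.mul_pos (Nat.ordProj_pos _ 2) (Nat.ordProj_pos _ 3)
      · positivity)
  calc 2 ^ ((q - 1).factorization 2) ≤ ordProj[2] (q ^ 2 - 1) * ordProj[3] (q ^ 2 - 1) :=
        two_pow_factorization_le_sixPart_sq_sub_one hq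
    _ ≤ ∏ r ∈ (N.primeFactors \ ℓ.primeFactors).erase 2, ordProj[2] (r ^ 2 - 1) * ordProj[3] (r ^ 2 - 1) := hP
    _ ≤ levelLoweringContent (-(ℓ : ℤ)) ((ℓ - 1 : ℕ) : ℤ) N ℓ *
          ∏ r ∈ (N.primeFactors \ ℓ.primeFactors).erase 2, ordProj[2] (r ^ 2 - 1) * ordProj[3] (r ^ 2 - 1) :=
        Nat.le_mul_of_pos_left _ hL
    _ ≤ (levelLoweringContent (-(ℓ : ℤ)) ((ℓ - 1 : ℕ) : ℤ) N ℓ *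
          ∏ r ∈ (N.primeFactors \ ℓ.primeFactors).erase 2, ordProj[2] (r ^ 2 - 1) * ordProj[3] (r ^ 2 - 1)) *
          ∏ p ∈ ℓ.primeFactors, min (ordProj[2] (p ^ 2 - 1) * ordProj[3] (p ^ 2 - 1))
            (2 ^ (resDepth 2 p 2 + B) * 3 ^ (resDepth 3 p 3 + B)) :=
        Nat.le_mul_of_pos_right _ hG

/-- **The tameness leaf of C″ is false**: `¬ Tame D_signBlind` — the Diamond–Ribet Euler budget
`𝓛 · ∏_{q ∣ N odd} sixPart(q² − 1)` exceeds `C N^ε 𝓛` along forced pairs, unconditionally. -/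
theorem not_tame_D_signBlind : ¬ Tame D_signBlind :=
  not_tame_of_forcedPairGrowth _ forcedPairGrowth_D_signBlind

/-- **The tameness leaf of C⁗ is false** for every gate width `B`. -/
theorem not_tame_D_residuacity (B : ℕ) : ¬ Tame (D_residuacity B) :=
  not_tame_of_forcedPairGrowth _ (forcedPairGrowth_D_residuacity B)

/-- **Decomposition verdict (kernel form).**  For each census-consistent allowance `D ∈ {C″, C⁗}`: the split
`EQ ⟸ QuarantineWith D ∧ Tame D` is valid and its second leaf is false; hence NO proof of the crux factors through
either allowance, and if `ξ` realises the `q`-charge at forced pairs (`ForcedPairGrowth twoPartXi = ForcedPairDepthLaw`,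
census-true) the crux is false (p134266). -/
theorem decomposition_verdict :
    (∀ D : Budget, QuarantineWith D → Tame D → EisensteinQuarantine) ∧
      ¬ Tame D_signBlind ∧ (∀ B, ¬ Tame (D_residuacity B)) ∧
      (ForcedPairGrowth twoPartXi → ¬ EisensteinQuarantine) :=
  ⟨eisensteinQuarantine_of_quarantineWith_of_tame, not_tame_D_signBlind, not_tame_D_residuacity,
    fun h => eisensteinQuarantine_false_of_forcedPairDepthLaw' (forcedPairDepthLaw_iff.mpr h)⟩


/-! ## §4 Transfer, typed: C″ IS the Diamond–Ribet / Greenberg–Wiles local budget at the Steinberg primes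

For `ρ = ρ_{E,2}` Steinberg at an odd prime `q` (`ρ|_{G_q} ≅ (εδ, *; 0, δ)`, `δ` unramified quadratic), the
`I_q`-coinvariants of `ρ ⊗ ℚ₂` are a line on which `Frob_q` acts by `ε⁻¹δ`, and the Greenberg–Wiles local term of the
adjoint Selmer group at `q` is generated by `det(1 − Frob_q⁻¹ q)` on it, i.e. by `1 − q²` up to the sign `δ(Frob_q)² = 1`
— [Cornell–Silverman–Stevens 1997, ch. XII (Diamond–Ribet), Prop. 4.3 and Lemma 4.4, p. 435: `c_p = 1 − p²` in the
rank-one-coinvariants case].  It is SIGN-BLIND (`δ` cancels) and its `{2,3}`-part is `sixPart(q² − 1)`: the per-prime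
charge of cdisprove's C″ and of the TRIAGE-r2-1 calibration `Sk = Σ v₂(q² − 1)`.  So `D_signBlind = 𝓛 · ∏ sixPart(c_q^{DR})`
literally (`D_signBlind_eq_diamondRibet`, `rfl`).  What does NOT transfer is the conversion of this Galois-side budget into
a statement about `ξ` at level `N`: that is an `R^{red} = 𝕋` theorem at `p = 2` for `ρ̄ = 1 ⊕ 1` (no Taylor–Wiles primes:
the auxiliary-prime argument needs `ρ̄(Frob)` with distinct eigenvalues [ibid. p. 520]; the residual pseudo-character
`1 + 1` is not multiplicity-free, so the Bellaïche–Chenevier/Wake–Wang-Erickson calculus of [arXiv:2209.00536] — which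
assumes `p ≥ 5` and proves `R = 𝕋` only under its Assumption 1.2.2, Conjecture 1.3.4 open — does not start). -/

/-- `sixPart n = ordProj[2] n · ordProj[3] n`, the `{2,3}`-part. -/
def sixPart (n : ℕ) : ℕ := ordProj[2] n * ordProj[3] n

theorem sixPart_pos (n : ℕ) : 0 < sixPart n := Nat.mul_pos (Nat.ordProj_pos n 2) (Nat.ordProj_pos n 3)

/-- `sixPart n ∣ n`. [folklore] -/
theorem sixPart_dvd (n : ℕ) : sixPart n ∣ n :=
  Nat.Coprime.mul_dvd_of_dvd_of_dvd (Nat.coprime_pow_primes _ _ Nat.prime_two Nat.prime_three (by decide))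
    (Nat.ordProj_dvd n 2) (Nat.ordProj_dvd n 3)

theorem sixPart_le {n : ℕ} (hn : n ≠ 0) : sixPart n ≤ n := Nat.le_of_dvd (Nat.pos_of_ne_zero hn) (sixPart_dvd n)

/-- The Diamond–Ribet local factor at a Steinberg prime `q` of `ρ_{E,2}` (up to sign): `c_q = q² − 1`.
[Cornell–Silverman–Stevens 1997, XII Lemma 4.4] -/
def cDR (q : ℕ) : ℕ := q ^ 2 - 1

/-- **C″'s allowance is the level-lowering content times the `{2,3}`-parts of the Diamond–Ribet local factors at the odd
level primes** (definitional). -/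
theorem D_signBlind_eq_diamondRibet :
    D_signBlind = fun a b N Nm => levelLoweringContent a b N Nm * ∏ q ∈ N.primeFactors.erase 2, sixPart (cDR q) := rfl

/-! ## §5 Strengthen (positive side, for the tenure restatement): the DIVISIBILITY form of C″

An `R = 𝕋` / Fitting-ideal argument outputs equalities of lengths prime by prime, never an `N^ε`; the rigid form of the
repaired crux is therefore a divisibility with a bounded defect per level prime.  `SixPartDvdEuler B` is that statement;
it implies `QuarantineWith` of the slackened sign-blind allowance pointwise (`C = 1`), and the slack `6^{B(ω(N)+1)}` is
`≤ C_δ N^δ` (`six_pow_card_primeFactors_le`, via `2^{ω(N)} ≤ τ(N) ≤ C_η N^η`), so it implies C″ = `QuarantineWith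
D_signBlind` itself (`quarantineWith_D_signBlind_of_sixPartDvdEuler`).  Cheapest falsifier: any census row with
`v₂ ξ > v₂ 𝓛 + Σ_{q ∣ N odd} v₂(q² − 1) + B(ω(N)+1)` for the working `B = 2` (none among cdisprove's 54 direct rows, where
C″ is tight at `(42, 673)`: `2^13 = 8·16·64`, nor among the lead's `j = 6` rows A/B, TRIAGE-r2-1/c6). -/

/-- **S⁺_div (B)**: `sixPart ξ(E; N/N⁻, N⁻) ∣ 6^{B(ω(N)+1)} · sixPart 𝓛 · ∏_{q ∣ N odd} sixPart(q² − 1)`. -/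
def SixPartDvdEuler (B : ℕ) : Prop :=
  ∀ a b : ℤ, IsCoprime a b → a * b * (a + b) ≠ 0 →
    ∀ (N : ℕ) [NeZero N], (freyCurve a b).conductorNorm ℤ = N →
      ∀ Nm : ℕ, Odd Nm → Squarefree Nm → Odd Nm.primeFactors.card → Nm ∣ N →
        sixPart (brandtXi (N / Nm) Nm (fun n => (freyCurve a b).LFunction n)) ∣
          6 ^ (B * (N.primeFactors.card + 1)) * sixPart (levelLoweringContent a b N Nm) *
            ∏ q ∈ N.primeFactors.erase 2, sixPart (q ^ 2 - 1)

/-- The slackened allowance `6^{B(ω(N)+1)} · D`. -/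
def slack (B : ℕ) (D : Budget) : Budget := fun a b N Nm => 6 ^ (B * (N.primeFactors.card + 1)) * D a b N Nm

/-- S⁺_div ⟹ `QuarantineWith (slack B D_signBlind)`, pointwise with constant `1`. -/
theorem quarantineWith_slack_of_sixPartDvdEuler {B : ℕ} (h : SixPartDvdEuler B) :
    QuarantineWith (slack B D_signBlind) := by
  intro ε hε
  refine ⟨1, fun a b hab h0 N _ hN Nm h1 h2 h3 h4 => ?_⟩
  have hd := h a b hab h0 N hN Nm h1 h2 h3 h4
  have hL : 1 ≤ levelLoweringContent a b N Nm := one_le_allowance h0 hN _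
  have hL0 : levelLoweringContent a b N Nm ≠ 0 := by omega
  have hP0 : ∏ q ∈ N.primeFactors.erase 2, sixPart (q ^ 2 - 1) ≠ 0 :=
    Finset.prod_ne_zero_iff.mpr fun q _ => (sixPart_pos _).ne'
  have hR0 : 6 ^ (B * (N.primeFactors.card + 1)) * sixPart (levelLoweringContent a b N Nm) *
      ∏ q ∈ N.primeFactors.erase 2, sixPart (q ^ 2 - 1) ≠ 0 :=
    Nat.mul_ne_zero (Nat.mul_ne_zero (pow_ne_zero _ (by norm_num)) (sixPart_pos _).ne') hP0
  have hle : sixPart (brandtXi (N / Nm) Nm (fun n => (freyCurve a b).LFunction n)) ≤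
      slack B D_signBlind a b N Nm := by
    refine (Nat.le_of_dvd (Nat.pos_of_ne_zero hR0) hd).trans ?_
    change _ ≤ 6 ^ (B * (N.primeFactors.card + 1)) * (levelLoweringContent a b N Nm *
      ∏ q ∈ N.primeFactors.erase 2, ordProj[2] (q ^ 2 - 1) * ordProj[3] (q ^ 2 - 1))
    rw [mul_assoc]
    exact Nat.mul_le_mul_left _ (Nat.mul_le_mul_right _ (sixPart_le hL0))
  have hN1 : (1 : ℝ) ≤ (N : ℝ) := by exact_mod_cast Nat.pos_of_ne_zero (NeZero.ne N)
  have hNε : (1 : ℝ) ≤ (N : ℝ) ^ ε := Real.one_le_rpow hN1 hε.le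
  have hS0 : (0 : ℝ) ≤ ((slack B D_signBlind a b N Nm : ℕ) : ℝ) := Nat.cast_nonneg _
  change ((sixPart (brandtXi (N / Nm) Nm (fun n => (freyCurve a b).LFunction n)) : ℕ) : ℝ) ≤ _
  calc ((sixPart (brandtXi (N / Nm) Nm (fun n => (freyCurve a b).LFunction n)) : ℕ) : ℝ)
      ≤ ((slack B D_signBlind a b N Nm : ℕ) : ℝ) := by exact_mod_cast hle
    _ = 1 * 1 * ((slack B D_signBlind a b N Nm : ℕ) : ℝ) := by ring
    _ ≤ 1 * (N : ℝ) ^ ε * ((slack B D_signBlind a b N Nm : ℕ) : ℝ) := by gcongr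

/-- `2^{ω(N)} ≤ τ(N)`. [folklore] -/
theorem two_pow_card_primeFactors_le_card_divisors {N : ℕ} (hN : N ≠ 0) :
    2 ^ N.primeFactors.card ≤ N.divisors.card := by
  rw [Nat.card_divisors hN]
  exact Finset.pow_card_le_prod _ _ _ fun p hp => by
    have := (Nat.prime_of_mem_primeFactors hp).factorization_pos_of_dvd hN (Nat.dvd_of_mem_primeFactors hp)
    omega

/-- The slack is sub-polynomial: `6^{B(ω(N)+1)} ≤ C_δ N^δ`. [folklore] -/
theorem six_pow_card_primeFactors_le {δ : ℝ} (hδ : 0 < δ) (B : ℕ) :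
    ∃ C : ℝ, 1 ≤ C ∧ ∀ N : ℕ, N ≠ 0 → ((6 ^ (B * (N.primeFactors.card + 1)) : ℕ) : ℝ) ≤ C * (N : ℝ) ^ δ := by
  have hη : 0 < δ / (3 * B + 1) := by positivity
  obtain ⟨Cd, hCd1, hCd⟩ := Literature.NumberTheory.Sieve.exists_card_divisors_le_mul_rpow hη
  have hCd0 : 0 ≤ Cd := zero_le_one.trans hCd1
  refine ⟨6 ^ B * Cd ^ (3 * B), one_le_mul_of_one_le_of_one_le (one_le_pow₀ (by norm_num)) (one_le_pow₀ hCd1),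
    fun N hN => ?_⟩
  -- in ℕ: 6^{B(ω+1)} ≤ 6^B · τ(N)^{3B}
  set ω := N.primeFactors.card with hω
  have hτ : 2 ^ ω ≤ N.divisors.card := two_pow_card_primeFactors_le_card_divisors hN
  have h8 : (8 : ℕ) ^ (B * ω) = (2 ^ ω) ^ (3 * B) := by
    rw [show (8 : ℕ) = 2 ^ 3 by norm_num, ← pow_mul, ← pow_mul]; congr 1; ring
  have hnat : 6 ^ (B * (ω + 1)) ≤ 6 ^ B * N.divisors.card ^ (3 * B) := by
    calc 6 ^ (B * (ω + 1)) = 6 ^ B * 6 ^ (B * ω) := by rw [mul_add_one, pow_add, mul_comm]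
      _ ≤ 6 ^ B * 8 ^ (B * ω) := Nat.mul_le_mul_left _ (Nat.pow_le_pow_left (by norm_num) _)
      _ = 6 ^ B * (2 ^ ω) ^ (3 * B) := by rw [h8]
      _ ≤ 6 ^ B * N.divisors.card ^ (3 * B) := Nat.mul_le_mul_left _ (Nat.pow_le_pow_left hτ _)
  -- in ℝ: τ(N)^{3B} ≤ (Cd N^η)^{3B} = Cd^{3B} N^{3Bη} ≤ Cd^{3B} N^δ
  have hN1 : (1 : ℝ) ≤ (N : ℝ) := by exact_mod_cast Nat.pos_of_ne_zero hN
  have hN0 : (0 : ℝ) ≤ (N : ℝ) := zero_le_one.trans hN1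
  have hτR : ((N.divisors.card : ℕ) : ℝ) ≤ Cd * (N : ℝ) ^ (δ / (3 * B + 1)) := hCd N hN
  have hτ0 : (0 : ℝ) ≤ ((N.divisors.card : ℕ) : ℝ) := Nat.cast_nonneg _
  have hexp : δ / (3 * B + 1) * ((3 * B : ℕ) : ℝ) ≤ δ := by
    have h3 : (0 : ℝ) < 3 * B + 1 := by positivity
    calc δ / (3 * B + 1) * ((3 * B : ℕ) : ℝ) ≤ δ / (3 * B + 1) * (3 * B + 1) := by
          push_cast; gcongr; linarith
      _ = δ := div_mul_cancel₀ δ h3.ne'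
  have hpowR : ((N.divisors.card : ℕ) : ℝ) ^ (3 * B) ≤ Cd ^ (3 * B) * (N : ℝ) ^ δ := by
    calc ((N.divisors.card : ℕ) : ℝ) ^ (3 * B) ≤ (Cd * (N : ℝ) ^ (δ / (3 * B + 1))) ^ (3 * B) :=
          pow_le_pow_left₀ hτ0 hτR _
      _ = Cd ^ (3 * B) * (N : ℝ) ^ (δ / (3 * B + 1) * ((3 * B : ℕ) : ℝ)) := by
          rw [mul_pow, Real.rpow_mul hN0, Real.rpow_natCast]
      _ ≤ Cd ^ (3 * B) * (N : ℝ) ^ δ :=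
          mul_le_mul_of_nonneg_left (Real.rpow_le_rpow_of_exponent_le hN1 hexp) (pow_nonneg hCd0 _)
  calc ((6 ^ (B * (ω + 1)) : ℕ) : ℝ) ≤ ((6 ^ B * N.divisors.card ^ (3 * B) : ℕ) : ℝ) := by exact_mod_cast hnat
    _ = (6 : ℝ) ^ B * ((N.divisors.card : ℕ) : ℝ) ^ (3 * B) := by push_cast; ring
    _ ≤ (6 : ℝ) ^ B * (Cd ^ (3 * B) * (N : ℝ) ^ δ) := mul_le_mul_of_nonneg_left hpowR (by positivity)
    _ = 6 ^ B * Cd ^ (3 * B) * (N : ℝ) ^ δ := by ring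

/-- The slack is absorbed by `N^ε`: `QuarantineWith (slack B D) → QuarantineWith D`. -/
theorem quarantineWith_of_slack {B : ℕ} {D : Budget} (h : QuarantineWith (slack B D)) : QuarantineWith D := by
  intro ε hε
  obtain ⟨C₁, hC₁⟩ := h (ε / 2) (half_pos hε)
  obtain ⟨C₂, hC₂1, hC₂⟩ := six_pow_card_primeFactors_le (half_pos hε) B
  refine ⟨max C₁ 0 * C₂, fun a b hab h0 N _ hN Nm h1 h2 h3 h4 => ?_⟩
  have hq := hC₁ a b hab h0 N hN Nm h1 h2 h3 h4
  have hs := hC₂ N (NeZero.ne N)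
  have hN0 : (0 : ℝ) < (N : ℝ) := by exact_mod_cast Nat.pos_of_ne_zero (NeZero.ne N)
  have hNe : (0 : ℝ) ≤ (N : ℝ) ^ (ε / 2) := Real.rpow_nonneg hN0.le _
  have hD0 : (0 : ℝ) ≤ ((D a b N Nm : ℕ) : ℝ) := Nat.cast_nonneg _
  have hM₁ : (0 : ℝ) ≤ max C₁ 0 := le_max_right _ _
  have hsplit : (N : ℝ) ^ (ε / 2) * (N : ℝ) ^ (ε / 2) = (N : ℝ) ^ ε := by
    rw [← Real.rpow_add hN0, add_halves]
  calc ((ordProj[2] (brandtXi (N / Nm) Nm (fun n => (freyCurve a b).LFunction n)) *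
          ordProj[3] (brandtXi (N / Nm) Nm (fun n => (freyCurve a b).LFunction n)) : ℕ) : ℝ)
      ≤ C₁ * (N : ℝ) ^ (ε / 2) * ((slack B D a b N Nm : ℕ) : ℝ) := hq
    _ ≤ max C₁ 0 * (N : ℝ) ^ (ε / 2) * ((slack B D a b N Nm : ℕ) : ℝ) := by gcongr; exact le_max_left _ _
    _ = max C₁ 0 * (N : ℝ) ^ (ε / 2) *
          (((6 ^ (B * (N.primeFactors.card + 1)) : ℕ) : ℝ) * ((D a b N Nm : ℕ) : ℝ)) := by
        simp only [slack, Nat.cast_mul]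
    _ ≤ max C₁ 0 * (N : ℝ) ^ (ε / 2) * ((C₂ * (N : ℝ) ^ (ε / 2)) * ((D a b N Nm : ℕ) : ℝ)) :=
        mul_le_mul_of_nonneg_left (mul_le_mul_of_nonneg_right hs hD0) (mul_nonneg hM₁ hNe)
    _ = max C₁ 0 * C₂ * ((N : ℝ) ^ (ε / 2) * (N : ℝ) ^ (ε / 2)) * ((D a b N Nm : ℕ) : ℝ) := by ring
    _ = max C₁ 0 * C₂ * (N : ℝ) ^ ε * ((D a b N Nm : ℕ) : ℝ) := by rw [hsplit]

/-- **S⁺_div ⟹ C″** (`QuarantineWith D_signBlind`). -/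
theorem quarantineWith_D_signBlind_of_sixPartDvdEuler {B : ℕ} (h : SixPartDvdEuler B) : QuarantineWith D_signBlind :=
  quarantineWith_of_slack (quarantineWith_slack_of_sixPartDvdEuler h)

/-- `QuarantineWith` is monotone in the allowance. -/
theorem quarantineWith_mono {D D' : Budget} (hle : ∀ a b N Nm, D a b N Nm ≤ D' a b N Nm) (h : QuarantineWith D) :
    QuarantineWith D' := by
  intro ε hε
  obtain ⟨C, hC⟩ := h ε hε
  refine ⟨max C 0, fun a b hab h0 N _ hN Nm h1 h2 h3 h4 => ?_⟩
  have hq := hC a b hab h0 N hN Nm h1 h2 h3 h4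
  have hN0 : (0 : ℝ) ≤ (N : ℝ) ^ ε := Real.rpow_nonneg (Nat.cast_nonneg _) _
  have hD' : ((D a b N Nm : ℕ) : ℝ) ≤ ((D' a b N Nm : ℕ) : ℝ) := by exact_mod_cast hle a b N Nm
  calc ((ordProj[2] (brandtXi (N / Nm) Nm (fun n => (freyCurve a b).LFunction n)) *
          ordProj[3] (brandtXi (N / Nm) Nm (fun n => (freyCurve a b).LFunction n)) : ℕ) : ℝ)
      ≤ C * (N : ℝ) ^ ε * ((D a b N Nm : ℕ) : ℝ) := hq
    _ ≤ max C 0 * (N : ℝ) ^ ε * ((D a b N Nm : ℕ) : ℝ) := by gcongr; exact le_max_left _ _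
    _ ≤ max C 0 * (N : ℝ) ^ ε * ((D' a b N Nm : ℕ) : ℝ) :=
        mul_le_mul_of_nonneg_left hD' (mul_nonneg (le_max_right _ _) hN0)

/-- … and hence, with the `SteinbergCore`-side companion `CoreWith` of the (junk-proofed) allowance `max 1 D_signBlind`,
the item the glue consumes (`XiStrongBound`, via the first strategist's `xiStrongBound_of_with`): the typed target of the
recommended RESTATE of binder `hEis`. -/
theorem xiStrongBound_of_sixPartDvdEuler {B : ℕ} (h : SixPartDvdEuler B)
    (hCore : CoreWith (fun a b N Nm => max 1 (D_signBlind a b N Nm))) : XiStrongBound :=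
  xiStrongBound_of_with (fun a b N Nm => max 1 (D_signBlind a b N Nm)) (fun _ _ _ _ => le_max_left _ _)
    (quarantineWith_mono (fun _ _ _ _ => le_max_right _ _) (quarantineWith_D_signBlind_of_sixPartDvdEuler h)) hCore

end Summit.ABC.ABC.Cruxes.EisensteinQuarantine.StrategistR1
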